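import Summits.ResolutionOfSingularities.ResolutionOfSingularities.Theorems.UniversalCellsCampaignW82PerfectionSpecialization
import Summits.ResolutionOfSingularities.ResolutionOfSingularities.Theorems.UniversalCellsCampaignW82PerfectionDescentAlgebra
import Summits.ResolutionOfSingularities.ResolutionOfSingularities.Theorems.UniversalCellsCampaignW82GeometricallyReduced
import Literature.AlgebraicGeometry.Resolution.LiuFlatIrreducible
import Literature.AlgebraicGeometry.Resolution.ResolutionOfComponents
import Mathlib.AlgebraicGeometry.Fiber
import HarnessLib

/-!
# [OURS · L1 W8.2] THE PERFECTION STEP IS REVERSIBLE: resolution over `(M(t))^{perf}` implies resolution over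
# `M`, for every infinite perfect field `M` of characteristic `p` (door 1 of slot W8.2)

Cell `res-hironaka` (run/shared/lean/pub/res-hironaka/), LADDER-RESOLUTION rung L (RESCUE), slot W8.2 of
plan/RESCUE-SEED.md («PRIME-FIELD / UNIVERSALITY TRANSFER instead of descent»); host route `UniversalCells`, host
item `PrimeFieldToPerfect` (stmt-ResolutionOfSingularities-15233). Proofs file (Theses-free), written by
res-L1-s82-pv-1 (gen 4).

THE CELL. The residual of door 1 is the PERFECTION STEP `CampaignW82.PerfectionStepAt M n` (≅ the kernel
`stub_climbRatFuncPerf` of stmt-15233): resolution in dimension `≤ n` over `M(t)` ⇒ resolution in dimension `≤ n`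
over every perfect `L ⊇ M(t)` purely inseparable over it (`L ≅ M(t)^{perf}`), `M` perfect — the UPWARD step of the
climb `𝔽_p ⊂ M₁ ⊂ M₂ ⊂ ⋯`, `M_{d+1} = M_d(t)^{perf}`, which is open from `n = 4` on. THIS FILE proves the DOWNWARD
step unconditionally: **`integralResUpToDim_of_isPurelyInseparable_ratFunc`** — for an INFINITE perfect `M` and
a perfect `L ⊇ M(t)` purely inseparable over `M(t)`, resolution in dimension `≤ n` over `L` implies resolution in
dimension `≤ n` over `M` (all `n : WithBot ℕ∞`; `integralResolutionOverUpToDim_of_isPurelyInseparable_ratFunc` is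
the ℕ-graded form by the tree's name `IntegralResolutionOverUpToDim`). So door 1's residual ladder is MONOTONE IN
THE CLIMB: `Res_{≤ n}(M_{d+1}) ⇒ Res_{≤ n}(M_d)` (`d ≥ 1`) — the door-1 companion of res-L1-s82-pv-2's door-2
monotonicity `Res((𝔽_p(t₁,…,t_{n+1}))^{alg}) ⇒ Res((𝔽_p(t₁,…,t_n))^{alg})` (`PrimeModelTransfer.integralResOver_subfield_of_integralResOver_subfield`).

PROOF. The general specialization theorem `hasResolution_of_hasResolution_baseChange_of_rationalPoints`
(`…PerfectionSpecialization.lean`: pv-2's door-2 proof with `IsAlgClosed` replaced by two hypotheses) applies to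
`M ⊆ L`: (i) `X ×_M L` is integral for every integral `X` of finite type over `M` —
**`isIntegral_pullback_specMap_of_isPurelyInseparable_ratFunc`** (§1: `X ×_M M(t)` is irreducible by Liu 4.3.8,
its generic fibre over `X` being `Spec (κ(ξ) ⊗_M M(t))`, a domain by `isDomain_tensor_ratFunc`; the purely
inseparable `L/M(t)` does not change the topology, `irreducibleSpace_pullback_of_isPurelyInseparable`; reduced since
`M` is perfect, `isReduced_pullback_specMap_of_perfectField`); (ii) `M`-rational closed points are dense in
`Spec R` for every finitely generated `M`-subalgebra `R` of `L` —
`exists_rationalPoint_of_algHom_of_isPurelyInseparable` (`…PerfectionDescentAlgebra.lean`; this is where `M` must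
be infinite: for `M = 𝔽_q` the statement is not available by this route, and not needed — `Res(𝔽_q)` follows
from the crux hypothesis `Res(𝔽_p)` by restriction of scalars).

HONEST FRAMING. OURS theorems about OURS statements (role replaced: §17 ¶2 p.89 l.59–62 of [Hironaka2017], typed AS
PRINTED as `S17Methodology.U89_3`); NOT statements of the manuscript; nothing attributed to its author; no typed
candidate used. No resolution is base-changed along an inseparable extension. The open upward step is untouched.
AI work, weaker than expert review; no claim beyond the kernel.

Sources: EGA IV₃ 8.10.5, IV₄ 17.7.8; Q. Liu, *Algebraic Geometry and Arithmetic Curves* (2002), Prop. 4.3.8;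
pv-2's specialization files (proof pattern). [cite: EGAIV3, Thm. 8.10.5] [cite: Liu2002, Prop. 4.3.8]
-/

noncomputable section

set_option linter.dupNamespace false -- mandated namespace of this single-conjunct summit

open CategoryTheory CategoryTheory.Limits AlgebraicGeometry TopologicalSpace
open Literature.AlgebraicGeometry.Resolution
open Summit.ResolutionOfSingularities.ResolutionOfSingularities.Theorems.PrimeModelTransfer
open scoped TensorProduct

namespace Summit.ResolutionOfSingularities.ResolutionOfSingularities.Theorems.CampaignW82

/-! ## §0 Graded and separated forms of the general specialization theorem -/

/-- **GRADED SPECIALIZATION, proper case: `Res_{≤ n}(L) ⇒ Res(X)` for proper integral `X` of dimension `≤ n` with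
`X_L` integral**, `K ⊆ L` with dense `K`-rational points as in
`hasResolution_of_hasResolution_baseChange_of_rationalPoints`: `dim X_L = dim X`
(`PrimeModelTransfer.topologicalKrullDim_baseChange_eq`), so `X_L` is resolvable by the graded hypothesis.
[cite: GortzWedhorn2020, Prop. 5.38] -/
theorem hasResolution_of_resUpToDim_extension_of_rationalPoints (K : Type) [Field K]
    (L : Type) [Field L] [Algebra K L] [PerfectField L]
    (hrat : ∀ (R : Type) [CommRing R] [Algebra K R], Algebra.FiniteType K R →
      ∀ ψ : R →ₐ[K] L, Function.Injective ψ →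
        ∀ O : Set (PrimeSpectrum R), IsOpen O → O.Nonempty →
          ∃ x ∈ O, x.asIdeal.IsMaximal ∧ Function.Bijective (algebraMap K (R ⧸ x.asIdeal)))
    (n : WithBot ℕ∞)
    (hL : ∀ (X : Scheme.{0}) (f : X ⟶ Spec (.of L)), IsSeparated f → LocallyOfFiniteType f →
      QuasiCompact f → IsIntegral X → topologicalKrullDim X ≤ n → Scheme.HasResolution X)
    (X : Scheme.{0}) (f : X ⟶ Spec (.of K)) [IsProper f] [IsIntegral X]
    [hXL : IsIntegral (pullback f (Spec.map (CommRingCat.ofHom (algebraMap K L))) : Scheme.{0})]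
    (hX : topologicalKrullDim X ≤ n) : Scheme.HasResolution X := by
  let i : Spec (.of L) ⟶ Spec (.of K) := Spec.map (CommRingCat.ofHom (algebraMap K L))
  refine hasResolution_of_hasResolution_baseChange_of_rationalPoints K L hrat X f
    (hL _ (pullback.snd f i) inferInstance inferInstance inferInstance hXL ?_)
  rw [topologicalKrullDim_baseChange_eq K L (IsPullback.of_hasPullback f i)]
  exact hX

/-- **GRADED SPECIALIZATION `Res_{≤ n}(L) ⇒ Res_{≤ n}(K)` for separated schemes of finite type**, `K ⊆ L` fields
with `L` perfect, dense `K`-rational points in the finitely generated `K`-subalgebras of `L` (`hrat`), and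
`X ×_K L` integral for every proper integral `X` over `K` (`hint`): graded Nagata reduction
(`PrimeModelTransfer.hasResolution_of_forall_proper_upToDim`) + the proper case. [cite: EGAIV3, Thm. 8.10.5] -/
theorem integralResUpToDim_of_extension_of_rationalPoints (K : Type) [Field K]
    (L : Type) [Field L] [Algebra K L] [PerfectField L]
    (hrat : ∀ (R : Type) [CommRing R] [Algebra K R], Algebra.FiniteType K R →
      ∀ ψ : R →ₐ[K] L, Function.Injective ψ →
        ∀ O : Set (PrimeSpectrum R), IsOpen O → O.Nonempty →
          ∃ x ∈ O, x.asIdeal.IsMaximal ∧ Function.Bijective (algebraMap K (R ⧸ x.asIdeal)))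
    (hint : ∀ (X : Scheme.{0}) (f : X ⟶ Spec (.of K)), IsProper f → IsIntegral X →
      IsIntegral (pullback f (Spec.map (CommRingCat.ofHom (algebraMap K L))) : Scheme.{0}))
    (n : WithBot ℕ∞)
    (hL : ∀ (X : Scheme.{0}) (f : X ⟶ Spec (.of L)), IsSeparated f → LocallyOfFiniteType f →
      QuasiCompact f → IsIntegral X → topologicalKrullDim X ≤ n → Scheme.HasResolution X)
    (X : Scheme.{0}) (f : X ⟶ Spec (.of K)) (hs : IsSeparated f) (hl : LocallyOfFiniteType f)
    (hq : QuasiCompact f) (hXi : IsIntegral X) (hdim : topologicalKrullDim X ≤ n) :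
    Scheme.HasResolution X :=
  hasResolution_of_forall_proper_upToDim K n
    (fun Y g hg hY hYd => by
      haveI := hg
      haveI := hY
      haveI := hint Y g hg hY
      exact hasResolution_of_resUpToDim_extension_of_rationalPoints K L hrat n hL Y g hYd) X f hdim

/-! ## §1 `X ×_M L` is integral for `L ⊇ M(t)` purely inseparable, `M` perfect -/

/-- **`X ×_M M(t)` is irreducible** for `X` irreducible over a field `M`: the projection `X ×_M M(t) ⟶ X` is flat,
and its generic fibre `Spec (κ(ξ) ⊗_M M(t))` is irreducible (`κ(ξ) ⊗_M M(t)` is a domain,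
`isDomain_tensor_ratFunc`), so Liu 4.3.8 (`irreducibleSpace_of_flat_of_irreducibleSpace_fiber`) applies.
[cite: Liu2002, Prop. 4.3.8] -/
theorem irreducibleSpace_pullback_specMap_ratFunc {M : Type} [Field M] {X : Scheme.{0}} (f : X ⟶ Spec (.of M))
    [IrreducibleSpace X] :
    IrreducibleSpace ↥(pullback f (Spec.map (CommRingCat.ofHom (algebraMap M (RatFunc M))))) := by
  set iK := Spec.map (CommRingCat.ofHom (algebraMap M (RatFunc M))) with hiK
  let q := pullback.fst f iK
  haveI : Flat iK := DeJong1996.Stage.flat_specMap _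
  haveI : Flat q := MorphismProperty.pullback_fst _ _ inferInstance
  -- the generic fibre of `q` is `Spec (κ(ξ) ⊗_M M(t))`
  set ξ := genericPoint X with hξ
  let g := X.fromSpecResidueField ξ
  obtain ⟨φ, hφ⟩ := Spec.map_surjective (g ≫ f)
  letI : Algebra M (X.residueField ξ) := φ.hom.toAlgebra
  have hφ' : Spec.map (CommRingCat.ofHom (algebraMap M (X.residueField ξ))) = g ≫ f := by
    rw [RingHom.algebraMap_toAlgebra, CommRingCat.ofHom_hom]; exact hφ
  haveI : IsDomain (X.residueField ξ ⊗[M] RatFunc M) := isDomain_tensor_ratFunc M (X.residueField ξ)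
  haveI : IrreducibleSpace ↥(Spec (CommRingCat.of (X.residueField ξ ⊗[M] RatFunc M))) :=
    inferInstanceAs (IrreducibleSpace (PrimeSpectrum (X.residueField ξ ⊗[M] RatFunc M)))
  let e : Spec (CommRingCat.of (X.residueField ξ ⊗[M] RatFunc M)) ⟶ q.fiber ξ :=
    (pullbackSpecIso M (X.residueField ξ) (RatFunc M)).inv ≫
      (pullback.congrHom hφ' rfl).hom ≫ (pullbackRightPullbackFstIso f iK g).inv ≫ (pullbackSymmetry q g).inv
  haveI : IsIso e := by dsimp only [e]; infer_instance
  haveI : IrreducibleSpace ↥(q.fiber ξ) := Function.Surjective.irreducibleSpace e.continuous e.surjective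
  exact irreducibleSpace_of_flat_of_irreducibleSpace_fiber q

/-- **`X ×_M L` is integral** for `X` integral and locally of finite type over a PERFECT field `M` and a field
`L ⊇ M(t)` purely inseparable over `M(t)` (with the composite `M`-algebra structure): irreducible by
`irreducibleSpace_pullback_specMap_ratFunc` and `irreducibleSpace_pullback_of_isPurelyInseparable` (a purely
inseparable ground field extension does not change the topology), reduced because `M` is perfect
(`isReduced_pullback_specMap_of_perfectField`). [folklore] -/
theorem isIntegral_pullback_specMap_of_isPurelyInseparable_ratFunc {M : Type} [Field M] [PerfectField M]
    {L : Type} [Field L] [Algebra (RatFunc M) L] [IsPurelyInseparable (RatFunc M) L] [Algebra M L]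
    [IsScalarTower M (RatFunc M) L] {X : Scheme.{0}} (f : X ⟶ Spec (.of M)) [LocallyOfFiniteType f]
    [IsIntegral X] : IsIntegral (pullback f (Spec.map (CommRingCat.ofHom (algebraMap M L)))) := by
  set K := RatFunc M with hK
  let iK := Spec.map (CommRingCat.ofHom (algebraMap M K))
  let iKL := Spec.map (CommRingCat.ofHom (algebraMap K L))
  let iL := Spec.map (CommRingCat.ofHom (algebraMap M L))
  have hcomp : iKL ≫ iK = iL := by
    change Spec.map _ ≫ Spec.map _ = Spec.map _
    rw [← Spec.map_comp, ← CommRingCat.ofHom_comp, ← IsScalarTower.algebraMap_eq M K L]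
  haveI : IrreducibleSpace ↥(pullback f iK) := irreducibleSpace_pullback_specMap_ratFunc f
  haveI : IrreducibleSpace ↥(pullback (pullback.snd f iK) iKL) :=
    irreducibleSpace_pullback_of_isPurelyInseparable (K := K) (L := L) (pullback.snd f iK)
  let e : pullback (pullback.snd f iK) iKL ⟶ pullback f iL :=
    (pullbackLeftPullbackSndIso f iK iKL).hom ≫ (pullback.congrHom rfl hcomp).hom
  haveI : IsIso e := by dsimp only [e]; infer_instance
  haveI : IrreducibleSpace ↥(pullback f iL) := Function.Surjective.irreducibleSpace e.continuous e.surjective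
  haveI : IsReduced (pullback f iL) := isReduced_pullback_specMap_of_perfectField (algebraMap M L) f
  exact isIntegral_of_irreducibleSpace_of_isReduced _

/-! ## §2 The inverse of the perfection step -/

/-- **THE PERFECTION STEP IS REVERSIBLE (graded).** Let `M` be an INFINITE perfect field of characteristic `p`
and `L` a perfect field, purely inseparable over `M(t) = RatFunc M` (e.g. `L = M(t)^{perf}`), with the composite
`M`-algebra structure. If every integral separated scheme of finite type over `L` of dimension `≤ n` has a
resolution, then so does every integral separated scheme of finite type over `M` of dimension `≤ n`. Proof:
`integralResUpToDim_of_extension_of_rationalPoints` (`…PerfectionSpecialization.lean`) with its two hypotheses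
supplied by `exists_rationalPoint_of_algHom_of_isPurelyInseparable` and
`isIntegral_pullback_specMap_of_isPurelyInseparable_ratFunc`. For the tower of door 1 (`M_{d+1} = M_d(t)^{perf}`,
`M_0 = 𝔽_p`): `Res_{≤ n}(M_{d+1}) ⇒ Res_{≤ n}(M_d)` for every `d ≥ 1`. [cite: EGAIV3, Thm. 8.10.5] -/
theorem integralResUpToDim_of_isPurelyInseparable_ratFunc (p : ℕ) [Fact p.Prime] (M : Type) [Field M]
    [CharP M p] [PerfectField M] [Infinite M] (L : Type) [Field L] [Algebra (RatFunc M) L]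
    [IsPurelyInseparable (RatFunc M) L] [PerfectField L] [Algebra M L] [IsScalarTower M (RatFunc M) L]
    (n : WithBot ℕ∞)
    (hL : ∀ (X : Scheme.{0}) (f : X ⟶ Spec (.of L)), IsSeparated f → LocallyOfFiniteType f →
      QuasiCompact f → IsIntegral X → topologicalKrullDim X ≤ n → Scheme.HasResolution X)
    (X : Scheme.{0}) (f : X ⟶ Spec (.of M)) (hs : IsSeparated f) (hl : LocallyOfFiniteType f)
    (hq : QuasiCompact f) (hX : IsIntegral X) (hdim : topologicalKrullDim X ≤ n) :
    Scheme.HasResolution X :=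
  integralResUpToDim_of_extension_of_rationalPoints M L
    (fun R _ _ hft ψ hψ O hO hne => by
      haveI := hft
      exact exists_rationalPoint_of_algHom_of_isPurelyInseparable p ψ hψ hO hne)
    (fun Y g hg hY => by
      haveI := hg
      haveI := hY
      exact isIntegral_pullback_specMap_of_isPurelyInseparable_ratFunc g)
    n hL X f hs hl hq hX hdim

/-- **All dimensions at once**: resolution of ALL integral separated schemes of finite type over `L` implies the
same over `M` (`n = ⊤`). [cite: EGAIV3, Thm. 8.10.5] -/
theorem integralRes_of_isPurelyInseparable_ratFunc (p : ℕ) [Fact p.Prime] (M : Type) [Field M] [CharP M p]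
    [PerfectField M] [Infinite M] (L : Type) [Field L] [Algebra (RatFunc M) L] [IsPurelyInseparable (RatFunc M) L]
    [PerfectField L] [Algebra M L] [IsScalarTower M (RatFunc M) L]
    (hL : ∀ (X : Scheme.{0}) (f : X ⟶ Spec (.of L)), IsSeparated f → LocallyOfFiniteType f →
      QuasiCompact f → IsIntegral X → Scheme.HasResolution X)
    (X : Scheme.{0}) (f : X ⟶ Spec (.of M)) (hs : IsSeparated f) (hl : LocallyOfFiniteType f)
    (hq : QuasiCompact f) (hX : IsIntegral X) : Scheme.HasResolution X :=
  integralResUpToDim_of_isPurelyInseparable_ratFunc p M L ⊤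
    (fun Y g hs' hl' hq' hY _ => hL Y g hs' hl' hq' hY) X f hs hl hq hX le_top

/-- **The ℕ-graded form, by the tree's name `IntegralResolutionOverUpToDim`**: for `M` infinite perfect of
characteristic `p` and `L ⊇ M(t)` perfect purely inseparable,
`IntegralResolutionOverUpToDim L d → IntegralResolutionOverUpToDim M d`. [cite: EGAIV3, Thm. 8.10.5] -/
theorem integralResolutionOverUpToDim_of_isPurelyInseparable_ratFunc (p : ℕ) [Fact p.Prime] (M : Type)
    [Field M] [CharP M p] [PerfectField M] [Infinite M] (L : Type) [Field L] [Algebra (RatFunc M) L]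
    [IsPurelyInseparable (RatFunc M) L] [PerfectField L] [Algebra M L] [IsScalarTower M (RatFunc M) L] (d : ℕ)
    (hL : IntegralResolutionOverUpToDim.{0} L d) : IntegralResolutionOverUpToDim.{0} M d :=
  fun X f hs hl hq hX hdim =>
    integralResUpToDim_of_isPurelyInseparable_ratFunc p M L (d : WithBot ℕ∞)
      (fun Y g hs' hl' hq' hY hYd => hL Y g hs' hl' hq' hY (by exact_mod_cast hYd)) X f hs hl hq hX
      (by exact_mod_cast hdim)

end Summit.ResolutionOfSingularities.ResolutionOfSingularities.Theorems.CampaignW82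

end
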